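import Summits.NavierStokesRegularity.NavierStokesRegularity.Theses.ExtremiserTransience
import Literature.Analysis.FluidPDE.KNSSThm53OfWindow

/-!
# `ExtremiserTransience`: the Galilean gauge implications between the LINE g4-β items (ns-idea-5 g4)

* `decayingSharpConstant_of_homogeneous : HomogeneousSharpConstant → DecayingSharpConstant` (drop a hypothesis);
* `norm_drift_le` : the drift `c = lim_{|x|→∞} v(x)` of a field bounded by `M` has `‖c‖ ≤ M`;
* `galileanGainLeTwo_of_decaying : DecayingSharpConstant → GalileanGainLeTwo` — apply the decaying-class
  inequality to `v − c` (same curl, same gradient, same `D¹, D²`; `‖v − c‖ ≤ 2M`).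
So item `GalileanGainLeTwo` (stmt-26688) closes by modus ponens once `DecayingSharpConstant` (stmt-26687) lands.
Nothing dynamic; Navier–Stokes regularity is not proved here.
-/

noncomputable section
open Set Filter Topology MeasureTheory
open scoped InnerProductSpace RealInnerProductSpace ENNReal NNReal ContDiff
open Literature.Analysis.FluidPDE
open Summit.NavierStokesRegularity.NavierStokesRegularity.Theses.ExtremiserTransience

namespace Summit.NavierStokesRegularity.NavierStokesRegularity.Theorems.DepletionLadder.GalileanGauge
set_option linter.style.longLine false

/-- `HomogeneousSharpConstant ⇒ DecayingSharpConstant` (the decaying class is a subclass). -/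
theorem decayingSharpConstant_of_homogeneous (h : HomogeneousSharpConstant) : DecayingSharpConstant := by
  intro v M B hv hdiv hM hB h1 h2 _hdec
  exact h v M B hv hdiv hM hB h1 h2

/-- the drift at infinity of a field bounded by `M` has norm at most `M`. -/
theorem norm_drift_le {v : EuclideanSpace ℝ (Fin 3) → EuclideanSpace ℝ (Fin 3)} {c : EuclideanSpace ℝ (Fin 3)} {M : ℝ}
    (hM : ∀ x, ‖v x‖ ≤ M) (hc : Tendsto (fun x => v x - c) (cocompact (EuclideanSpace ℝ (Fin 3))) (𝓝 0)) : ‖c‖ ≤ M := by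
  have hv : Tendsto v (cocompact (EuclideanSpace ℝ (Fin 3))) (𝓝 c) := by
    have h := hc.add_const c
    simpa using h
  exact le_of_tendsto' hv.norm fun x => hM x

/-- derivatives of positive order do not see a constant shift. -/
theorem iteratedFDeriv_succ_sub_const (v : EuclideanSpace ℝ (Fin 3) → EuclideanSpace ℝ (Fin 3)) (c : EuclideanSpace ℝ (Fin 3)) (n : ℕ) :
    iteratedFDeriv ℝ (n + 1) (fun x => v x - c) = iteratedFDeriv ℝ (n + 1) v := by
  ext1 x
  rw [iteratedFDeriv_succ_eq_comp_right, iteratedFDeriv_succ_eq_comp_right]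
  simp only [Function.comp, fderiv_sub_const]

/-- `DecayingSharpConstant ⇒ GalileanGainLeTwo`: apply the decaying-class inequality to `v − c`. -/
theorem galileanGainLeTwo_of_decaying (h : DecayingSharpConstant) : GalileanGainLeTwo := by
  intro v c M B hv hdiv hM hB h1 h2 hdec
  have hw_smooth : ContDiff ℝ (⊤ : ℕ∞) (fun x => v x - c) := hv.sub contDiff_const
  have hw_div : VectorCalculus.IsDivFree (fun x => v x - c) := isDivFree_sub_const hdiv c
  have hcM : ‖c‖ ≤ M := norm_drift_le hM hdec
  have hw_bd : ∀ x, ‖v x - c‖ ≤ 2 * M := fun x => (norm_sub_le _ _).trans (by linarith [hM x])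
  have hF : fderiv ℝ (fun x => v x - c) = fderiv ℝ v := funext fun x => fderiv_sub_const c
  have hw_B : ∀ x, ‖fderiv ℝ (fun y => v y - c) x‖ ≤ B := fun x => by rw [hF]; exact hB x
  have hi1 : iteratedFDeriv ℝ 1 (fun x => v x - c) = iteratedFDeriv ℝ 1 v := iteratedFDeriv_succ_sub_const v c 0
  have hi2 : iteratedFDeriv ℝ 2 (fun x => v x - c) = iteratedFDeriv ℝ 2 v := iteratedFDeriv_succ_sub_const v c 1
  have key := h (fun x => v x - c) (2 * M) B hw_smooth hw_div hw_bd hw_B (by rw [hi1]; exact h1)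
    (by rw [hi2]; exact h2) hdec
  rw [curl_sub_const_eq, hF] at key
  exact key.trans_eq (by ring)

end Summit.NavierStokesRegularity.NavierStokesRegularity.Theorems.DepletionLadder.GalileanGauge

end
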